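import Summits.BirchSwinnertonDyer.Rank1Residual.X11b.BDPRouteNoRam
import Summits.BirchSwinnertonDyer.Rank1Residual.X11b.BDPRouteSurjOdd
import HarnessLib

/-!
# Class X11b, route "BDP + converse-theorem engine + Kolyvagin": the WHOLE-CLASS theorem modulo its typed inputs (cell `b2b-bsdres`, sub-cell `multr1-p2`, gen 7)

HONEST FRAMING (cell `b2b-bsdres`, run/shared/lean/b2b/bsd-rank1-residual/, verbatim in every
file): the goal of the cell is to DELETE the COMBINATION-SHAPED residual classes of the
Birch–Swinnerton-Dyer formula for ALL analytic-rank `≤ 1` elliptic curves over `ℚ` — "full BSD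
formula for every rank `≤ 1` curve in class `C`" assembled STRICTLY from published theorems — so
that the rank-`≤ 1` remainder becomes exactly the CONSTRUCTION-SHAPED classes, which are TYPED
(missing-input `Prop`s), NOT attempted. This is not "finishing BSD". Sub-cell `multr1-p2` is a
RESEARCH ROUTE on class X11b (`ClassX11b W p`: `ord_{s=1} L(E,s) = 1`, `p ≠ 2`, multiplicative
reduction at `p`, `E[p]` irreducible); no claim beyond the stated class; nothing is booked; X11b's
label (CONSTRUCTION-SHAPED) does not change.

## What this file does

Gens 2–6 settled route p2 ATOM BY ATOM (`HOME/b2b-bsdres-multr1-p2/SUMMARY.md`): on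
`(ram) ∧ p ∤ ∏c_ℓ` the Euler-system half is a theorem and `BSD(E,p) ⟺ STEP L`
(`BDPRouteRigidityClass`); on `(ram) ∧ p ∣ ∏c_ℓ` the lower half is `⇐ STEP L` and the upper half
carries Kolyvagin's Tamagawa defect (`BDPRouteTamagawaDefect`, `BDPRouteOddPrimeClass`); on
`¬(ram) ∧ surj` the lower half is `⇐ STEP L` (`BDPRouteSurj`, `BDPRouteSurjOdd`) and the upper half
`⇐` the main-conjecture half of the rank-`0` sister class X11a at `p` (`BDPRouteNoRam`). This file
assembles those atoms into ONE statement of the shape the cell asks of a class theorem,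
`∀ E/ℚ, ∀ p, ClassX11b(E,p) → BSD_p(E)`, whose hypotheses are PUBLISHED named facts plus an
explicit, finite list of TYPED inputs, one per atom:

* (T1) STEP L = `IndexLowerBoundAt W p K P` at the odd-`d_K` Manin-good Heegner data of the
  surjective X11b pairs — the route's ONE unpublished `Λ`-adic input (Jetchev–Skinner–Wan 2017
  §7.4.1 at `p ∥ N`; printed proof Castella 2018 Thm. 4.4 WITHDRAWN by the author's erratum; the
  erratum's replacement rests on Fouquet–Wan arXiv:2107.13726 Thm. 4.41, unrefereed);
* (T2) the Euler-system half `Typed.MissingUpperBoundAt W p` where `p ∣ ∏_ℓ c_ℓ(E)` (Kolyvagin's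
  method loses exactly `2·ord_p ∏c_ℓ` there — `padicValNat_shaOrder_le_add_of_classX11b_of_ram_odd`;
  the sharp bound is the Shimura-curve / Ribet–Takahashi degree-ratio programme, planners' business);
* (T3) the main-conjecture half `Typed.MissingLowerBoundAt` on class X11a at `p` (feeds the upper
  half of the `¬`(ram) atom through the Heegner twists, which are X11a pairs —
  `classX11a_twist_of_not_ram`);
* (T4) the non-surjective corner `¬ Surj W p` (then `¬ Ram W p`, `not_ram_of_not_surj`; images
  `S₄` / normaliser-of-Cartan; 64 of the 2 267 348 X11b-shape pairs with `p ≥ 5`, `N < 5·10⁵`, none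
  with `N < 2·10⁴`): both halves typed, `Typed.MissingPPartAt W p` (X9-type; no published lever).

Main results: `missingLowerBoundAt_of_classX11b_odd_of_typedInputs` (lower half on ALL of X11b at
every odd `p` ⇐ (T1) + (T4)), `missingUpperBoundAt_of_classX11b_five_of_typedInputs` (upper half on
all of X11b at `p ≥ 5` ⇐ (T2) + (T3) + (T4), the (ram) ∧ `p ∤ ∏c_ℓ` part UNCONDITIONAL),
**`bsdp_of_classX11b_five_of_typedInputs`** (`∀ (E,p) ∈ X11b, p ≥ 5 → BSD(E,p)` ⇐ (T1)–(T4) and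
twelve published facts), and the every-odd-prime variant `bsdp_of_classX11b_odd_of_typedInputs`
(`p = 3` included; there the `¬`(ram) atom's upper half is typed outright, (T2′), because the
X11a-twist lever `BDPRouteNoRam` is printed for `p ≥ 5`). Everything here is re-assembly of tree
theorems; no definition, no new named fact, nothing asserted about the open inputs.

References: [JetchevSkinnerWan2017] §7.4.1–7.4.3; [Castella2018] Thm. 4.4, (1.1); [Castella2018Erratum];
[Kolyvagin1990] Thm. A (McCallum 1991 §1); [Skinner2016PacificMC] Thm. C; [Wuthrich2014] Prop. 21;
[HoffsteinLuo1997]; [FriedbergHoffstein1995]; [Mazur1978] Cor. 4.1; [Serre1972] Prop. 15;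
[Miller2011LMS] Def. 1.1.
-/

noncomputable section

open scoped Classical

open WeierstrassCurve NumberField Literature.NumberTheory.EllipticCurves
  Literature.NumberTheory.EllipticCurves.ModularForms
  Literature.NumberTheory.EllipticCurves.Rank1Residual
  Literature.NumberTheory.EllipticCurves.Rank1Residual.Typed
  Literature.NumberTheory.EllipticCurves.Wuthrich2014

namespace Summit.BirchSwinnertonDyer.Rank1Residual.X11b

/-! ### The atoms of X11b -/

/-- On X11b a non-surjective pair has no (ram) prime: `E[p]` irreducible and a (ram) prime force
`ρ̄_{E,p}` onto (`surj_of_irr_of_ram`, Serre 1972 Prop. 15 + Tate-curve inertia). So the corner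
(T4) `¬ Surj` lies inside the `¬`(ram) atom. [cite: Serre1972, §2.4 Prop. 15] -/
theorem not_ram_of_not_surj (W : WeierstrassCurve ℚ) [W.IsElliptic] [W.IsGloballyMinimal] (p : ℕ)
    [Fact p.Prime]
    (hX : ClassX11b W p) (hns : ¬ Surj W p) : ¬ Ram W p :=
  fun hram ↦ hns (surj_of_irr_of_ram W p hX.2.2.2 hram)

/-- **The four atoms of X11b** (pure logic, recorded for the map in `SUMMARY.md`): every pair is in
exactly the position the route's theorems address — (ram) ∧ `p ∤ ∏c_ℓ` (the Locus at `p ≥ 5`),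
(ram) ∧ `p ∣ ∏c_ℓ`, `¬`(ram) ∧ surj, or the non-surjective corner (which is `¬`(ram) by
`not_ram_of_not_surj`). [folklore] -/
theorem classX11b_atoms (W : WeierstrassCurve ℚ) [W.IsElliptic] [W.IsGloballyMinimal] (p : ℕ)
    [Fact p.Prime]
    (hX : ClassX11b W p) :
    (Ram W p ∧ ¬ p ∣ W.tamagawaProduct) ∨ (Ram W p ∧ p ∣ W.tamagawaProduct) ∨
      (¬ Ram W p ∧ Surj W p) ∨ (¬ Ram W p ∧ ¬ Surj W p) := by
  by_cases hs : Surj W p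
  · by_cases hram : Ram W p
    · by_cases ht : p ∣ W.tamagawaProduct
      · exact Or.inr (Or.inl ⟨hram, ht⟩)
      · exact Or.inl ⟨hram, ht⟩
    · exact Or.inr (Or.inr (Or.inl ⟨hram, hs⟩))
  · exact Or.inr (Or.inr (Or.inr ⟨not_ram_of_not_surj W p hX hs, hs⟩))

/-! ### The main-conjecture half on the whole class, every odd prime: (T1) + (T4) -/

/-- **Lower half of `BSD(E,p)` on ALL of X11b at every odd prime, from (T1) STEP L on the surjective
pairs and (T4) the typed corner.** For every `(E,p)` in X11b (`p` odd, `p = 3` included):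
`ord_p #Ш(E)_an ≤ ord_p #Ш(E)` (`Typed.MissingLowerBoundAt W p`), given the nine PUBLISHED facts of
`missingLowerBoundAt_of_classX11b_of_surj_odd` (Gross–Zagier, Kolyvagin, Wuthrich 2014 Prop. 21, GZK,
modularity ×2, Hoffstein–Luo, Mazur Cor. 4.1, Néron), STEP L at the odd-`d_K` Heegner data of the
surjective pairs (`hL`, OPEN at `p ∥ N`), and `Typed.MissingPPartAt` on the non-surjective corner
(`hC`, OPEN). CONDITIONAL; nothing booked. [cite: Wuthrich2014, Prop. 21 (p. 400)]
[cite: JetchevSkinnerWan2017, §7.4.1 (pp. 30–31)] [cite: Miller2011LMS, Def. 1.1] -/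
theorem missingLowerBoundAt_of_classX11b_odd_of_typedInputs
    -- published inputs (named facts of the tree)
    (hGZ : ∀ (N : ℕ) [NeZero N] (W : WeierstrassCurve ℚ) (K : Type) [Field K] [NumberField K],
      gross_zagier N W K)
    (hKo : ∀ (N : ℕ) [NeZero N] (W : WeierstrassCurve ℚ) (K : Type) [Field K] [NumberField K],
      kolyvagin N W K)
    (hWu : sha_dvd_analyticSha)
    (hGZK : rank_eq_analyticRank_of_analyticRank_le_one) (hmod : hasEntireLFunction_rat)
    (hnf : exists_isNewformOf) (hHL : HoffsteinLuo1997_exists_twist_L_one_ne_zero)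
    (hMaz : mazur_not_dvd_maninConstant_of_odd) (hNS : integral_neronScaling_of_isGloballyMinimal)
    -- (T1) the typed input of the route (STEP L), at the odd-`d_K` Heegner data of surjective X11b pairs
    (hL : ∀ (W : WeierstrassCurve ℚ) [W.IsElliptic] [W.IsGloballyMinimal] (p : ℕ) [Fact p.Prime]
      (N : ℕ) [NeZero N] (K : Type) [Field K] [NumberField K]
      (Dt : ModularParametrizationData W N) (H : HeegnerDatum N (NumberField.discr K)) (ι : K →+* ℂ)
      (P : (W.baseChange K).toAffine.Point),
      ClassX11b W p → Surj W p → W.conductorNorm ℤ = N → IsImaginaryQuadratic K →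
      Odd (NumberField.discr K) → ¬ (p : ℤ) ∣ NumberField.discr K → ¬ p ∣ Units.torsionOrder K →
      SatisfiesHeegnerHypothesis N K →
      (W.quadraticTwist (NumberField.discr K : ℚ)).entireLFunction 1 ≠ 0 →
      WeierstrassCurve.Affine.Point.map ι.toRatAlgHom P = heegnerPointComplex Dt H →
      ¬ (p : ℤ) ∣ Dt.c → IndexLowerBoundAt W p K P)
    -- (T4) the non-surjective corner, both halves typed
    (hC : ∀ (W : WeierstrassCurve ℚ) [W.IsElliptic] [W.IsGloballyMinimal] (p : ℕ) [Fact p.Prime],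
      ClassX11b W p → ¬ Surj W p → Typed.MissingPPartAt W p) :
    ∀ (W : WeierstrassCurve ℚ) [W.IsElliptic] [W.IsGloballyMinimal] (p : ℕ) [Fact p.Prime],
      ClassX11b W p → Typed.MissingLowerBoundAt W p := by
  intro W _ _ p _ hX
  by_cases hs : Surj W p
  · exact missingLowerBoundAt_of_classX11b_of_surj_odd hGZ hKo hWu hGZK hmod hnf hHL hMaz hNS hL W p
      hX hs
  · exact (Typed.lower_and_upper_of_missingPPartAt W p (hC W p hX hs)).1

/-! ### The Euler-system half on the whole class at `p ≥ 5`: (T2) + (T3) + (T4), Locus unconditional -/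

/-- **Upper half of `BSD(E,p)` on ALL of X11b at `p ≥ 5`.** For every `(E,p)` in X11b with `p ≥ 5`:
`ord_p #Ш(E) ≤ ord_p #Ш(E)_an` (`Typed.MissingUpperBoundAt W p`), given the PUBLISHED facts
(Gross–Zagier, Kolyvagin ×2, Skinner 2016 Thm. C, GZK, modularity ×2, Hoffstein–Luo,
Friedberg–Hoffstein, Mazur Cor. 4.1, Néron) and the typed inputs (T2) `hU` (upper half where
`p ∣ ∏c_ℓ`), (T3) `hX11a` (lower half on the rank-`0` class X11a at `p`, for the `¬`(ram) ∧ surj ∧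
`p ∤ ∏c_ℓ` atom via `missingUpperBoundAt_of_classX11b_of_not_ram_of_lowerX11a`) and (T4) `hC` (the
non-surjective corner). On (ram) ∧ `p ∤ ∏c_ℓ` NO typed input is used
(`missingUpperBoundAt_of_classX11b_of_ram_of_not_dvd`, unconditional). CONDITIONAL elsewhere;
nothing booked. [cite: McCallumLMS1991, §1 Theorem (Kolyvagin), p. 296]
[cite: Skinner2016PacificMC, Thm. C (§1) and footnote 1] [cite: Miller2011LMS, Def. 1.1] -/
theorem missingUpperBoundAt_of_classX11b_five_of_typedInputs
    -- published inputs (named facts of the tree)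
    (hGZ : ∀ (N : ℕ) [NeZero N] (W : WeierstrassCurve ℚ) (K : Type) [Field K] [NumberField K],
      gross_zagier N W K)
    (hKo : ∀ (N : ℕ) [NeZero N] (W : WeierstrassCurve ℚ) (K : Type) [Field K] [NumberField K],
      kolyvagin N W K)
    (hB : ∀ (N : ℕ) [NeZero N] (W : WeierstrassCurve ℚ) (K : Type) [Field K] [NumberField K],
      Kolyvagin1990_padicValNat_card_sha_le N W K)
    (hSk : Skinner2016.thmC_padicValRat_bsd_rank_zero)
    (hGZK : rank_eq_analyticRank_of_analyticRank_le_one) (hmod : hasEntireLFunction_rat)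
    (hnf : exists_isNewformOf) (hHL : HoffsteinLuo1997_exists_twist_L_one_ne_zero)
    (hFH : friedbergHoffstein_exists_heegnerField_split_twist_ne_zero)
    (hMaz : mazur_not_dvd_maninConstant_of_odd) (hNS : integral_neronScaling_of_isGloballyMinimal)
    -- (T2) the Euler-system half where `p ∣ ∏ c_ℓ`
    (hU : ∀ (W : WeierstrassCurve ℚ) [W.IsElliptic] [W.IsGloballyMinimal] (p : ℕ) [Fact p.Prime],
      ClassX11b W p → 5 ≤ p → p ∣ W.tamagawaProduct → Typed.MissingUpperBoundAt W p)
    -- (T3) the main-conjecture half on the rank-0 sister class X11a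
    (hX11a : ∀ (Wd : WeierstrassCurve ℚ) [Wd.IsElliptic] [Wd.IsGloballyMinimal] (p : ℕ)
      [Fact p.Prime], ClassX11a Wd p → Typed.MissingLowerBoundAt Wd p)
    -- (T4) the non-surjective corner, both halves typed
    (hC : ∀ (W : WeierstrassCurve ℚ) [W.IsElliptic] [W.IsGloballyMinimal] (p : ℕ) [Fact p.Prime],
      ClassX11b W p → ¬ Surj W p → Typed.MissingPPartAt W p) :
    ∀ (W : WeierstrassCurve ℚ) [W.IsElliptic] [W.IsGloballyMinimal] (p : ℕ) [Fact p.Prime],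
      ClassX11b W p → 5 ≤ p → Typed.MissingUpperBoundAt W p := by
  intro W _ _ p _ hX hp5
  by_cases ht : p ∣ W.tamagawaProduct
  · exact hU W p hX hp5 ht
  by_cases hram : Ram W p
  · exact missingUpperBoundAt_of_classX11b_of_ram_of_not_dvd hGZ hKo hB hSk hGZK hmod hnf hHL hMaz
      hNS W p hX hram ht
  by_cases hs : Surj W p
  · exact missingUpperBoundAt_of_classX11b_of_not_ram_of_lowerX11a hGZ hKo hB hGZK hmod hnf hFH hMaz
      hNS W p hX hp5 hram hs ht (fun Wd _ _ hXa ↦ hX11a Wd p hXa)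
  · exact (Typed.lower_and_upper_of_missingPPartAt W p (hC W p hX hs)).2

/-! ### The whole-class theorem -/

/-- **X11b, whole class, `p ≥ 5`: `BSD(E,p)` for EVERY pair `(E,p)` of X11b with `p ≥ 5`, from
twelve PUBLISHED named facts and the four TYPED inputs (T1) STEP L, (T2) the upper half where
`p ∣ ∏c_ℓ`, (T3) X11a's lower half at `p`, (T4) the non-surjective corner.** This is the cell's
class-theorem shape `∀ E/ℚ, ∀ p, ClassC(E,p) → BSD_p(E)` for `C = X11b` with the residual inputs
named and separated: the route DELETES nothing (every typed input is OPEN), but it pins the whole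
class on exactly these four statements, of which (T1) is a single `Λ`-adic divisibility at the
trivial character (`BDPRouteLinks`) and is RIGID on (ram) (`BDPRouteRigidityClass`:
`BSD ⟺ STEP L` on the Locus). Published inputs: Gross–Zagier `hGZ`, Kolyvagin `hKo`/`hB`,
Skinner 2016 Thm. C `hSk`, Wuthrich 2014 Prop. 21 `hWu`, GZK `hGZK`, modularity `hmod`/`hnf`,
Hoffstein–Luo `hHL`, Friedberg–Hoffstein `hFH`, Mazur 1978 Cor. 4.1 `hMaz`, Néron `hNS`.
CONDITIONAL; nothing booked; X11b stays CONSTRUCTION-SHAPED. [cite: JetchevSkinnerWan2017, §7.4.1–7.4.3 (pp. 30–31)]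
[cite: McCallumLMS1991, §1 Theorem (Kolyvagin), p. 296] [cite: Skinner2016PacificMC, Thm. C (§1) and footnote 1]
[cite: Wuthrich2014, Prop. 21 (p. 400)] [cite: Mazur1978, Cor. 4.1] [cite: Miller2011LMS, Def. 1.1] -/
theorem bsdp_of_classX11b_five_of_typedInputs
    -- published inputs (named facts of the tree)
    (hGZ : ∀ (N : ℕ) [NeZero N] (W : WeierstrassCurve ℚ) (K : Type) [Field K] [NumberField K],
      gross_zagier N W K)
    (hKo : ∀ (N : ℕ) [NeZero N] (W : WeierstrassCurve ℚ) (K : Type) [Field K] [NumberField K],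
      kolyvagin N W K)
    (hB : ∀ (N : ℕ) [NeZero N] (W : WeierstrassCurve ℚ) (K : Type) [Field K] [NumberField K],
      Kolyvagin1990_padicValNat_card_sha_le N W K)
    (hSk : Skinner2016.thmC_padicValRat_bsd_rank_zero) (hWu : sha_dvd_analyticSha)
    (hGZK : rank_eq_analyticRank_of_analyticRank_le_one) (hmod : hasEntireLFunction_rat)
    (hnf : exists_isNewformOf) (hHL : HoffsteinLuo1997_exists_twist_L_one_ne_zero)
    (hFH : friedbergHoffstein_exists_heegnerField_split_twist_ne_zero)
    (hMaz : mazur_not_dvd_maninConstant_of_odd) (hNS : integral_neronScaling_of_isGloballyMinimal)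
    -- (T1) the typed input of the route (STEP L), at the odd-`d_K` Heegner data of surjective X11b pairs
    (hL : ∀ (W : WeierstrassCurve ℚ) [W.IsElliptic] [W.IsGloballyMinimal] (p : ℕ) [Fact p.Prime]
      (N : ℕ) [NeZero N] (K : Type) [Field K] [NumberField K]
      (Dt : ModularParametrizationData W N) (H : HeegnerDatum N (NumberField.discr K)) (ι : K →+* ℂ)
      (P : (W.baseChange K).toAffine.Point),
      ClassX11b W p → Surj W p → W.conductorNorm ℤ = N → IsImaginaryQuadratic K →
      Odd (NumberField.discr K) → ¬ (p : ℤ) ∣ NumberField.discr K → ¬ p ∣ Units.torsionOrder K →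
      SatisfiesHeegnerHypothesis N K →
      (W.quadraticTwist (NumberField.discr K : ℚ)).entireLFunction 1 ≠ 0 →
      WeierstrassCurve.Affine.Point.map ι.toRatAlgHom P = heegnerPointComplex Dt H →
      ¬ (p : ℤ) ∣ Dt.c → IndexLowerBoundAt W p K P)
    -- (T2) the Euler-system half where `p ∣ ∏ c_ℓ`
    (hU : ∀ (W : WeierstrassCurve ℚ) [W.IsElliptic] [W.IsGloballyMinimal] (p : ℕ) [Fact p.Prime],
      ClassX11b W p → 5 ≤ p → p ∣ W.tamagawaProduct → Typed.MissingUpperBoundAt W p)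
    -- (T3) the main-conjecture half on the rank-0 sister class X11a
    (hX11a : ∀ (Wd : WeierstrassCurve ℚ) [Wd.IsElliptic] [Wd.IsGloballyMinimal] (p : ℕ)
      [Fact p.Prime], ClassX11a Wd p → Typed.MissingLowerBoundAt Wd p)
    -- (T4) the non-surjective corner, both halves typed
    (hC : ∀ (W : WeierstrassCurve ℚ) [W.IsElliptic] [W.IsGloballyMinimal] (p : ℕ) [Fact p.Prime],
      ClassX11b W p → ¬ Surj W p → Typed.MissingPPartAt W p) :
    ∀ (W : WeierstrassCurve ℚ) [W.IsElliptic] [W.IsGloballyMinimal] (p : ℕ) [Fact p.Prime],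
      ClassX11b W p → 5 ≤ p → BSDp W p := by
  intro W _ _ p _ hX hp5
  exact Typed.bsdp_of_missingPPartAt W p hGZK (by rw [hX.1])
    (Typed.missingPPartAt_of_lower_of_upper W p
      (missingLowerBoundAt_of_classX11b_odd_of_typedInputs hGZ hKo hWu hGZK hmod hnf hHL hMaz hNS hL
        hC W p hX)
      (missingUpperBoundAt_of_classX11b_five_of_typedInputs hGZ hKo hB hSk hGZK hmod hnf hHL hFH hMaz
        hNS hU hX11a hC W p hX hp5))

/-- **X11b, whole class, EVERY ODD PRIME (`p = 3` included)**: `BSD(E,p)` for every pair of X11b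
from eleven PUBLISHED facts and three TYPED inputs — (T1) STEP L on the surjective pairs, (T2′) the
Euler-system half wherever the pair is NOT in the unconditional atom (ram) ∧ `p ∤ ∏c_ℓ` (i.e.
`p ∣ ∏c_ℓ` or no (ram) prime; at `p ≥ 5` the `¬`(ram) ∧ surj ∧ `p ∤ ∏c_ℓ` part of (T2′) is
replaced by X11a's lower half, `bsdp_of_classX11b_five_of_typedInputs`), (T4) the non-surjective
corner. At `p = 3` STEP L has no source even announced (both announced statements carry `5 ≤ p`).
CONDITIONAL; nothing booked; labels unchanged. [cite: JetchevSkinnerWan2017, §7.4.1–7.4.3 (pp. 30–31)]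
[cite: McCallumLMS1991, §1 Theorem (Kolyvagin), p. 296] [cite: Skinner2016PacificMC, Thm. C (§1) and footnote 1]
[cite: Wuthrich2014, Prop. 21 (p. 400)] [cite: Miller2011LMS, Def. 1.1] -/
theorem bsdp_of_classX11b_odd_of_typedInputs
    -- published inputs (named facts of the tree)
    (hGZ : ∀ (N : ℕ) [NeZero N] (W : WeierstrassCurve ℚ) (K : Type) [Field K] [NumberField K],
      gross_zagier N W K)
    (hKo : ∀ (N : ℕ) [NeZero N] (W : WeierstrassCurve ℚ) (K : Type) [Field K] [NumberField K],
      kolyvagin N W K)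
    (hB : ∀ (N : ℕ) [NeZero N] (W : WeierstrassCurve ℚ) (K : Type) [Field K] [NumberField K],
      Kolyvagin1990_padicValNat_card_sha_le N W K)
    (hSk : Skinner2016.thmC_padicValRat_bsd_rank_zero) (hWu : sha_dvd_analyticSha)
    (hGZK : rank_eq_analyticRank_of_analyticRank_le_one) (hmod : hasEntireLFunction_rat)
    (hnf : exists_isNewformOf) (hHL : HoffsteinLuo1997_exists_twist_L_one_ne_zero)
    (hMaz : mazur_not_dvd_maninConstant_of_odd) (hNS : integral_neronScaling_of_isGloballyMinimal)
    -- (T1) the typed input of the route (STEP L), at the odd-`d_K` Heegner data of surjective X11b pairs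
    (hL : ∀ (W : WeierstrassCurve ℚ) [W.IsElliptic] [W.IsGloballyMinimal] (p : ℕ) [Fact p.Prime]
      (N : ℕ) [NeZero N] (K : Type) [Field K] [NumberField K]
      (Dt : ModularParametrizationData W N) (H : HeegnerDatum N (NumberField.discr K)) (ι : K →+* ℂ)
      (P : (W.baseChange K).toAffine.Point),
      ClassX11b W p → Surj W p → W.conductorNorm ℤ = N → IsImaginaryQuadratic K →
      Odd (NumberField.discr K) → ¬ (p : ℤ) ∣ NumberField.discr K → ¬ p ∣ Units.torsionOrder K →
      SatisfiesHeegnerHypothesis N K →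
      (W.quadraticTwist (NumberField.discr K : ℚ)).entireLFunction 1 ≠ 0 →
      WeierstrassCurve.Affine.Point.map ι.toRatAlgHom P = heegnerPointComplex Dt H →
      ¬ (p : ℤ) ∣ Dt.c → IndexLowerBoundAt W p K P)
    -- (T2′) the Euler-system half off the unconditional atom (ram) ∧ `p ∤ ∏ c_ℓ`
    (hU : ∀ (W : WeierstrassCurve ℚ) [W.IsElliptic] [W.IsGloballyMinimal] (p : ℕ) [Fact p.Prime],
      ClassX11b W p → Surj W p → ¬ (Ram W p ∧ ¬ p ∣ W.tamagawaProduct) →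
        Typed.MissingUpperBoundAt W p)
    -- (T4) the non-surjective corner, both halves typed
    (hC : ∀ (W : WeierstrassCurve ℚ) [W.IsElliptic] [W.IsGloballyMinimal] (p : ℕ) [Fact p.Prime],
      ClassX11b W p → ¬ Surj W p → Typed.MissingPPartAt W p) :
    ∀ (W : WeierstrassCurve ℚ) [W.IsElliptic] [W.IsGloballyMinimal] (p : ℕ) [Fact p.Prime],
      ClassX11b W p → BSDp W p := by
  intro W _ _ p _ hX
  refine Typed.bsdp_of_missingPPartAt W p hGZK (by rw [hX.1]) ?_
  by_cases hs : Surj W p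
  · refine Typed.missingPPartAt_of_lower_of_upper W p
      (missingLowerBoundAt_of_classX11b_of_surj_odd hGZ hKo hWu hGZK hmod hnf hHL hMaz hNS hL W p hX
        hs) ?_
    by_cases hloc : Ram W p ∧ ¬ p ∣ W.tamagawaProduct
    · exact missingUpperBoundAt_of_classX11b_of_ram_of_not_dvd hGZ hKo hB hSk hGZK hmod hnf hHL hMaz
        hNS W p hX hloc.1 hloc.2
    · exact hU W p hX hs hloc
  · exact hC W p hX hs

end Summit.BirchSwinnertonDyer.Rank1Residual.X11b

end
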